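import Literature.MathematicalPhysics.QuantumFieldTheory.Balaban1983to89.B12Eq213HistoryTowerSharp
import Literature.MathematicalPhysics.QuantumFieldTheory.Balaban1983to89.B12Eq213SecondDifference

/-!
# BalabanUVNodes ∕ N22 knit, THE SECOND-ORDER HISTORY TOWER ON THE (2.13) BODY — the twin seat's body-level chain
# (`B12Eq213HistoryTowerSharp`: CONSTANT first-order history moduli; `B12Eq213SecondDifference`: the comparison principle at second
# order, vertex-free) composed BY NAME into the tower of SECOND DIFFERENCES of the total small-field action — and of Bałaban's subtracted new
# term — in every OLDER coupling: LINEAR growth in the age, no smallness (Track A, DAG node N22 = NE9; cluster K4 «SpineRates»; seat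
# `pub-ymgap-dag-n22-a`, successor step (3) of its g0 HANDOFF)

HONEST FRAMING.  Count-neutral kernel bookkeeping; NOT a node discharge; NE5 ∕ NE9 NOT IN PRINT, NOT PROVED.  Every theorem here is about
the TYPED (2.13) body (`B12Eq213Body268.FluctData`, r20) under DISPLAYED hypotheses — the recursion (0.23)∕(2.11)–(2.13) read on the body and
the located analytic inputs per step (integrability, positivity, first- and second-order letters); UN-LOCALISED (sup-currency on the small-field
domains: the `e^{−κd_j(X)}` weights and the per-domain split of [Balaban1988RG2Cluster] (2.14) are the object W1, not here).  One finite
four-torus programme at fixed ε; nothing continuum ∕ ℝ⁴ ∕ OS ∕ mass-gap ∕ Clay.  0 `sorry`, 0 `def`, standard axioms.  `--supports` item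
`SpineGivenEndpoint` (route «BalabanUVNodes», cluster K4).

WHY.  ROAD 2 to node N22 (`BalabanUVNodesN22Knit{,Discrete,Recursion,FiniteTower}`) derives `NE9 ∧ FadingMemory` from (P) prefix dependence
+ (O) oscillation fading at the tower η-rate `θ` (= node N18 at the run lengths below the level) + ONE regularity letter whose constants may
GROW geometrically in the age, `μ^{age}` with `θμ < 1`; `N22KnitRecursion` showed that a SECOND-ORDER STEP INEQUALITY of the recursion
supplies that letter with growth `ν` for every `ν > max(ω + c, μ₁²)`.  The twin seat `pub-ymgap-dag-n22-b` has since landed, on the (2.13)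
body: (L1) with `μ₁ = 1` — the carried old action CANCELS against the curly bracket's subtraction (`newTerm_bracket_add_carried`), so the
a-priori history moduli are CONSTANT in the age (`abs_action_sub_action_le_tower_unsubtracted`, p412895) — and the two vertex-free
second-order inputs (S2-last) `abs_secondDiff_newTerm_coupling_le`, (S2-old) `abs_secondDiff_newTerm_withQ_le` (p413651:
`|Λ(F₊) − 2Λ(F₀) + Λ(F₋)| ≤ s₂ + 2s₁²` for `Λ(F) = log∫χe^{F}`).  THIS FILE composes them (the -a seat's map [DAGN22A-G0-COORD-1] executed):
* §1 `prefix_eq` — (P) for the body tower, DERIVED: under the un-subtracted recursion (2.1)∕(2.11)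
  `E (k+1) h U = newTerm {D k with Q := 𝐄_k^h ∘ τ k} (h k) U + R k (h k) U` and no history at step 0, `E k h` depends on `h 0, …, h (k−1)`
  only ([Balaban1987RG1] p. 256 in words — here a one-line induction).
* §2 ONE STEP: `abs_step_secondDiff_old` — SECOND ORDER, OLDER COUPLING: three old actions (`s₁`-close, second difference `≤ s₂` on `Dom k`)
  in the bracket at the SAME last coupling ⟹ the new total actions have second difference `≤ s₂ + 2s₁²` (the remainder cancels);
  `abs_step_le_sharp_of_lip` — FIRST ORDER with a NEW-TERM-LEVEL last-coupling modulus (the currency the Gaussian body supplies,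
  `B12Eq213GaussianLastCoupling`): factor ONE on the old closeness, as in module 9's `abs_step_le_sharp`.
* §3 TOWERS: `abs_action_sub_action_le_tower_of_lip` — module 9's CONSTANT-moduli tower re-run with the new-term-level last-coupling
  modulus: `|𝐄_k(g′; U) − 𝐄_k(g; U)| ≤ (L + L_R)·Σ_{i<k}|g′_i − g_i|`; **`abs_secondDiff_action_le_linear_of_shapes`** — THE SECOND-ORDER
  TOWER from two SHAPES, (L1) constant first-order history moduli `L₁` of the total action (module 9's conclusion, any currency) and (B2) a
  second-difference bound `ℓ₂·d²` for the new total action in its LAST coupling (the birth step, any currency): for every history `g` in the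
  window, every OLDER coupling `i < k`, every triple `t − d, t, t + d` in the window and every `U ∈ Dom k`,
  `|𝐄_k(g[i ↦ t+d]; U) − 2𝐄_k(g[i ↦ t]; U) + 𝐄_k(g[i ↦ t−d]; U)| ≤ (ℓ₂ + 2L₁²·(k − 1 − i))·d²` — LINEAR growth in the age, NO smallness
  anywhere (induction on the age: birth at `k = i + 1` by (B2) + §1; each later step adds the variance channel `2(L₁d)²` by
  `abs_step_secondDiff_old` and carries the old second difference with factor ONE); `abs_secondDiff_newTerm_le_linear_of_shapes` — the same
  for Bałaban's SUBTRACTED new term `𝐄^{(k+1)}` of (2.13) (`newTerm_bracket_add_carried`): `≤ 2·(ℓ₂ + 2L₁²(k − i))·d²`.  The two letter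
  currencies (exponent-level `L_P, L_τ, L_R, M_P, M_τ, M_R` via module 9 + (S2-last); new-term-level `L, L_R, λ₂, M_R` via
  `abs_action_sub_action_le_tower_of_lip`) are instanced in the companion file `BalabanUVNodesN22KnitBodyTowerLetters`.
READING.  By Bernoulli, `ℓ₂ + 2L₁²·n ≤ (ℓ₂ + 2L₁²∕(ν−1))·ν^{n}` for EVERY `ν > 1` (`BalabanUVNodesN22KnitLinear.linear_le_geometric`): the
body's letter has the (R₂) SHAPE of `N22KnitDiscrete` with growth `ν` for every `ν > 1`, so on ROAD 2 the E-side carries NO smallness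
condition once localized — only the tower rate `θ < 1` of node N18 is spent (`BalabanUVNodesN22KnitLinear`: every fading rate
`τ ∈ (√θ, 1]`).  RESIDUAL PROPER TO N22 ON ROAD 2 AFTER THIS FILE: (O) = node N18 (in-edge), the located letters per step, and the
LOCALIZATION of §3's tower into the `e^{−κd_j(X)}`-weighted per-domain letter — the object W1 ([Balaban1988RG2Cluster] §§1–2); the
regularity letter itself is no longer «not in print for the older couplings» at body level: it is §3, for every older coupling, with
linear constants.

References (TYPES only): [Balaban1987RG1] = T. Bałaban, Commun. Math. Phys. **109** (1987) 249–301 — (0.23) p. 256, (1.17)–(1.18) and the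
C^∞ clause p. 263, (2.1) p. 265, (2.11)–(2.14) pp. 267–268, p. 298; [Balaban1988RG2Cluster] = T. Bałaban, Commun. Math. Phys. **116**
(1988) 1–22 — §§1–2.
-/

noncomputable section

namespace Summit.QuantumFields.YangMills.BalabanUVNodes.N22KnitBodyTower

open MeasureTheory Set
open scoped BigOperators
open Literature.MathematicalPhysics.QuantumFieldTheory.Balaban1983to89
open Literature.MathematicalPhysics.QuantumFieldTheory.Balaban1983to89.B12Eq213Body268 (FluctData)
open Literature.MathematicalPhysics.QuantumFieldTheory.Balaban1983to89.B12Eq213CouplingDependence (abs_newTerm_withQ_sub_newTerm_le)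
open Literature.MathematicalPhysics.QuantumFieldTheory.Balaban1983to89.B12Eq213HistoryTowerSharp (newTerm_bracket_add_carried)
open Literature.MathematicalPhysics.QuantumFieldTheory.Balaban1983to89.B12Eq213SecondDifference
  (abs_secondDiff_newTerm_withQ_le)

/-! ## §1 Prefix dependence of the body tower, derived -/

section Body

variable {Y : Type*}

/-- **(P) FOR THE BODY TOWER, DERIVED.**  Under the un-subtracted recursion (2.1)∕(2.11)
`E (k+1) h U = newTerm {D k with Q := 𝐄_k^h ∘ τ k} (h k) U + R k (h k) U` for histories in the window and no history at step 0, two histories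
agreeing at the indices `< k` have the same total action after `k` steps, everywhere on `Y` ([Balaban1987RG1] p. 256: *«The function 𝐄_k
depends also on the effective coupling constants g₀, …, g_{k−1}»*). [cite: Balaban1987RG1, §0 (0.23) p.256 and (2.11)–(2.13) pp.267–268] -/
theorem prefix_eq (D : ℕ → FluctData Y) (τ : (k : ℕ) → ℝ → Y → (D k).𝓑 → Y) (R : ℕ → ℝ → Y → ℝ)
    (E : ℕ → (ℕ → ℝ) → Y → ℝ) (W : Set ℝ)
    (hE0 : ∀ h h' : ℕ → ℝ, ∀ U, E 0 h U = E 0 h' U)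
    (hrec : ∀ (h : ℕ → ℝ) (k : ℕ) (U : Y), (∀ i, h i ∈ W) →
      E (k + 1) h U = FluctData.newTerm { D k with Q := fun a U B => E k h (τ k a U B) } (h k) U + R k (h k) U) :
    ∀ (k : ℕ) (h h' : ℕ → ℝ), (∀ i, h i ∈ W) → (∀ i, h' i ∈ W) → (∀ i < k, h i = h' i) → ∀ U, E k h U = E k h' U := by
  intro k
  induction k with
  | zero => intro h h' _ _ _ U; exact hE0 h h' U
  | succ k ih =>
    intro h h' hh hh' hagree U
    have hfun : E k h = E k h' := funext fun V => ih h h' hh hh' (fun i hi => hagree i (Nat.lt_succ_of_lt hi)) V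
    rw [hrec h k U hh, hrec h' k U hh', hfun, hagree k (Nat.lt_succ_self k)]

/-- The history discrepancy of two single-coordinate updates: `Σ_{j<k} |g[i ↦ s] j − g[i ↦ s'] j| = |s − s'|` for `i < k`. [folklore] -/
theorem sum_abs_update_sub_update (g : ℕ → ℝ) {i k : ℕ} (hik : i < k) (s s' : ℝ) :
    ∑ j ∈ Finset.range k, |Function.update g i s j - Function.update g i s' j| = |s - s'| := by
  rw [Finset.sum_eq_single_of_mem i (Finset.mem_range.2 hik) fun j _ hji => by
    rw [Function.update_of_ne hji, Function.update_of_ne hji, sub_self, abs_zero]]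
  rw [Function.update_self, Function.update_self]

/-- A single-coordinate update of a history in the window `W^ℕ` by a value of `W` stays in the window. [folklore] -/
theorem update_mem_of_mem {W : Set ℝ} {g : ℕ → ℝ} (hg : ∀ j, g j ∈ W) (i : ℕ) {s : ℝ} (hs : s ∈ W) :
    ∀ j, Function.update g i s j ∈ W := by
  intro j
  rcases eq_or_ne j i with rfl | hji
  · rwa [Function.update_self]
  · rw [Function.update_of_ne hji]; exact hg j

/-! ## §2 One step: second order in an older coupling (three old actions in the bracket); first order with a new-term-level last-coupling modulus -/

/-- **ONE STEP, SECOND ORDER, OLDER COUPLING.**  Three old actions `E₋, E₀, E₊ : Y → ℝ` (one old action under three histories differing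
in ONE older coupling) with `|E₀ − E₋| ≤ s₁` and `|E₊ − 2E₀ + E₋| ≤ s₂` on `Dom k`, read through the bracket's coupling curve `τ` at the SAME
last coupling `a` (integrable integrands, positive middle integral, `τ a U B ∈ Dom k` on the support of `χ_U`): the three new total actions
`newTerm {D with Q := E_• ∘ τ} a U + R a U` have second difference `≤ s₂ + 2s₁²` — module 11's linear channel + variance channel; the
history-free remainder cancels. [cite: Balaban1987RG1, (2.11)–(2.13) pp.267–268 and §0 p.256] -/
theorem abs_step_secondDiff_old (D : FluctData Y) (τ : ℝ → Y → D.𝓑 → Y) (R : ℝ → Y → ℝ) (Em E₀ Ep : Y → ℝ)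
    (S : Set Y) {s₁ s₂ a : ℝ} {U : Y}
    (h1 : ∀ y ∈ S, |E₀ y - Em y| ≤ s₁) (h2 : ∀ y ∈ S, |Ep y - 2 * E₀ y + Em y| ≤ s₂)
    (hτ : ∀ B, D.χ U B ≠ 0 → τ a U B ∈ S)
    (him : Integrable (FluctData.integrand { D with Q := fun a U B => Em (τ a U B) } a U) (D.μ U))
    (hi0 : Integrable (FluctData.integrand { D with Q := fun a U B => E₀ (τ a U B) } a U) (D.μ U))
    (hip : Integrable (FluctData.integrand { D with Q := fun a U B => Ep (τ a U B) } a U) (D.μ U))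
    (hpos : 0 < FluctData.integral { D with Q := fun a U B => E₀ (τ a U B) } a U) :
    |(FluctData.newTerm { D with Q := fun a U B => Ep (τ a U B) } a U + R a U)
      - 2 * (FluctData.newTerm { D with Q := fun a U B => E₀ (τ a U B) } a U + R a U)
      + (FluctData.newTerm { D with Q := fun a U B => Em (τ a U B) } a U + R a U)| ≤ s₂ + 2 * s₁ ^ 2 := by
  have h := abs_secondDiff_newTerm_withQ_le { D with Q := fun a U B => E₀ (τ a U B) }
    (fun a U B => Em (τ a U B)) (fun a U B => Ep (τ a U B)) him hi0 hip hpos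
    (fun B hB => h1 _ (hτ B hB)) (fun B hB => h2 _ (hτ B hB))
  have e : (FluctData.newTerm { D with Q := fun a U B => Ep (τ a U B) } a U + R a U)
      - 2 * (FluctData.newTerm { D with Q := fun a U B => E₀ (τ a U B) } a U + R a U)
      + (FluctData.newTerm { D with Q := fun a U B => Em (τ a U B) } a U + R a U)
      = FluctData.newTerm { D with Q := fun a U B => Ep (τ a U B) } a U
        - 2 * FluctData.newTerm { D with Q := fun a U B => E₀ (τ a U B) } a U
        + FluctData.newTerm { D with Q := fun a U B => Em (τ a U B) } a U := by ring
  rw [e]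
  exact h

/-- **ONE STEP, FIRST ORDER, NEW-TERM-LEVEL LAST-COUPLING MODULUS** (un-subtracted form; module 9's `abs_step_le_sharp` in the currency the
Gaussian body supplies): two histories' old actions `s`-close on `Dom k`, brackets `𝐄_k ∘ τ`, `𝐄′_k ∘ τ`; if the second history's new term is
`L`-Lipschitz between the two last couplings `a, a′` and the remainder is `L_R`-Lipschitz, the new total actions are
`s + (L + L_R)·|a′ − a|`-close — factor ONE on `s` (the comparison principle `abs_newTerm_withQ_sub_newTerm_le` at the common coupling).
[cite: Balaban1987RG1, (2.11)–(2.13) pp.267–268 and §0 (0.23) p.256] -/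
theorem abs_step_le_sharp_of_lip (D : FluctData Y) (τ : ℝ → Y → D.𝓑 → Y) (R : ℝ → Y → ℝ) (Ek Ek' : Y → ℝ)
    (S : Set Y) {s L LR a a' : ℝ} {U : Y} (hS : ∀ y ∈ S, |Ek' y - Ek y| ≤ s)
    (hτ : ∀ B, D.χ U B ≠ 0 → τ a U B ∈ S)
    (hint : Integrable (FluctData.integrand { D with Q := fun a U B => Ek (τ a U B) } a U) (D.μ U))
    (hint' : Integrable (FluctData.integrand { D with Q := fun a U B => Ek' (τ a U B) } a U) (D.μ U))
    (hpos : 0 < FluctData.integral { D with Q := fun a U B => Ek (τ a U B) } a U)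
    (hN : |FluctData.newTerm { D with Q := fun a U B => Ek' (τ a U B) } a' U -
        FluctData.newTerm { D with Q := fun a U B => Ek' (τ a U B) } a U| ≤ L * |a' - a|)
    (hR : |R a' U - R a U| ≤ LR * |a' - a|) :
    |(FluctData.newTerm { D with Q := fun a U B => Ek' (τ a U B) } a' U + R a' U) -
      (FluctData.newTerm { D with Q := fun a U B => Ek (τ a U B) } a U + R a U)| ≤ s + (L + LR) * |a' - a| := by
  have h2 : |FluctData.newTerm { D with Q := fun a U B => Ek' (τ a U B) } a U -
      FluctData.newTerm { D with Q := fun a U B => Ek (τ a U B) } a U| ≤ s :=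
    abs_newTerm_withQ_sub_newTerm_le { D with Q := fun a U B => Ek (τ a U B) } (fun a U B => Ek' (τ a U B))
      hint hint' hpos (fun B hB => hS _ (hτ B hB))
  rw [show (FluctData.newTerm { D with Q := fun a U B => Ek' (τ a U B) } a' U + R a' U) -
      (FluctData.newTerm { D with Q := fun a U B => Ek (τ a U B) } a U + R a U)
      = (FluctData.newTerm { D with Q := fun a U B => Ek' (τ a U B) } a' U -
          FluctData.newTerm { D with Q := fun a U B => Ek' (τ a U B) } a U)
        + (FluctData.newTerm { D with Q := fun a U B => Ek' (τ a U B) } a U -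
          FluctData.newTerm { D with Q := fun a U B => Ek (τ a U B) } a U)
        + (R a' U - R a U) by ring]
  calc _ ≤ |FluctData.newTerm { D with Q := fun a U B => Ek' (τ a U B) } a' U -
          FluctData.newTerm { D with Q := fun a U B => Ek' (τ a U B) } a U|
        + |FluctData.newTerm { D with Q := fun a U B => Ek' (τ a U B) } a U -
          FluctData.newTerm { D with Q := fun a U B => Ek (τ a U B) } a U|
        + |R a' U - R a U| := abs_add_three _ _ _
    _ ≤ L * |a' - a| + s + LR * |a' - a| := add_le_add (add_le_add hN h2) hR
    _ = s + (L + LR) * |a' - a| := by ring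

/-! ## §3 The towers: constant first-order moduli (new-term currency); second differences with LINEAR growth in the age -/

/-- **THE CONSTANT-MODULI TOWER WITH A NEW-TERM-LEVEL LAST-COUPLING MODULUS** (module 9's `abs_action_sub_action_le_tower_unsubtracted`,
re-run in the currency of `B12Eq213GaussianLastCoupling` ∕ module 3 v1.1): per step the step datum `D k`, the coupling curve `τ k`, the
remainder `R k`, domains `Dom k`; the total old action `E k h`; no history at step 0, the un-subtracted recursion, domain compatibility,
integrability ∕ positivity, and per step ONE new-term-level Lipschitz constant `L` in the last coupling (for every history of the window) and
`L_R` for the remainder.  CONCLUSION: `|𝐄_k(g′; U) − 𝐄_k(g; U)| ≤ (L + L_R)·Σ_{i<k} |g′_i − g_i|` on `Dom k` — CONSTANT history moduli.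
[cite: Balaban1987RG1, §0 (0.23) p.256, (2.11)–(2.13) pp.267–268 and §5 p.298] -/
theorem abs_action_sub_action_le_tower_of_lip (D : ℕ → FluctData Y) (τ : (k : ℕ) → ℝ → Y → (D k).𝓑 → Y)
    (R : ℕ → ℝ → Y → ℝ) (E : ℕ → (ℕ → ℝ) → Y → ℝ) (Dom : ℕ → Set Y) (W : Set ℝ) {L LR : ℝ}
    (g g' : ℕ → ℝ) (hg : ∀ k, g k ∈ W) (hg' : ∀ k, g' k ∈ W)
    (hE0 : ∀ U, E 0 g' U = E 0 g U)
    (hrec : ∀ (h : ℕ → ℝ) (k : ℕ) (U : Y), (∀ i, h i ∈ W) →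
      E (k + 1) h U = FluctData.newTerm { D k with Q := fun a U B => E k h (τ k a U B) } (h k) U + R k (h k) U)
    (hτ : ∀ k U, U ∈ Dom (k + 1) → ∀ a ∈ W, ∀ B, (D k).χ U B ≠ 0 → τ k a U B ∈ Dom k)
    (hint : ∀ (h : ℕ → ℝ) (k : ℕ), (∀ i, h i ∈ W) → ∀ U ∈ Dom (k + 1), ∀ a ∈ W,
      Integrable (FluctData.integrand { D k with Q := fun a U B => E k h (τ k a U B) } a U) ((D k).μ U))
    (hpos : ∀ (h : ℕ → ℝ) (k : ℕ), (∀ i, h i ∈ W) → ∀ U ∈ Dom (k + 1), ∀ a ∈ W,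
      0 < FluctData.integral { D k with Q := fun a U B => E k h (τ k a U B) } a U)
    (hN : ∀ (h : ℕ → ℝ) (k : ℕ), (∀ i, h i ∈ W) → ∀ U ∈ Dom (k + 1), ∀ a ∈ W, ∀ a' ∈ W,
      |FluctData.newTerm { D k with Q := fun a U B => E k h (τ k a U B) } a' U -
        FluctData.newTerm { D k with Q := fun a U B => E k h (τ k a U B) } a U| ≤ L * |a' - a|)
    (hR : ∀ k, ∀ U ∈ Dom (k + 1), ∀ a ∈ W, ∀ a' ∈ W, |R k a' U - R k a U| ≤ LR * |a' - a|) :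
    ∀ k, ∀ U ∈ Dom k, |E k g' U - E k g U| ≤ (L + LR) * ∑ i ∈ Finset.range k, |g' i - g i| := by
  intro k
  induction k with
  | zero => intro U _; simp [hE0 U]
  | succ k ih =>
    intro U hU
    rw [hrec g' k U hg', hrec g k U hg, Finset.sum_range_succ, mul_add]
    exact abs_step_le_sharp_of_lip (D k) (τ k) (R k) (E k g) (E k g') (Dom k)
      (s := (L + LR) * ∑ i ∈ Finset.range k, |g' i - g i|) ih
      (fun B hB => hτ k U hU (g k) (hg k) B hB)
      (hint g k hg U hU (g k) (hg k)) (hint g' k hg' U hU (g k) (hg k)) (hpos g k hg U hU (g k) (hg k))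
      (hN g' k hg' U hU (g k) (hg k) (g' k) (hg' k)) (hR k U hU (g k) (hg k) (g' k) (hg' k))

/-- **THE SECOND-ORDER HISTORY TOWER ON THE (2.13) BODY, FROM TWO SHAPES.**  Data per step `k` as in `B12Eq213HistoryTowerSharp`: the step
datum `D k` (measures `dμ_{C^{(k)}(U)}`, cut-off `χ_k`, `𝐏^{(k)}`), the bracket's coupling curve `τ k` (= `a ↦ U_k(exp i[aCB − hD̃(aCB)]V^{(k)}(U))`),
the history-free remainder `R k`, small-field domains `Dom k`, the total old action `E k h : Y → ℝ` of a history `h`; a window `W ⊆ ℝ` for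
every coupling.  Hypotheses (displayed): no history at step 0; the un-subtracted recursion (2.1)∕(2.11) (= (2.12) on the domains, module 9's
cancellation); domain compatibility of `τ`; integrability ∕ positivity of the un-subtracted integrals for every history of the window; and two
SHAPES — (L1) CONSTANT first-order history moduli `L₁` of the total action on the domains (module 9's conclusion
`abs_action_sub_action_le_tower_unsubtracted`, or `abs_action_sub_action_le_tower_of_lip`), (B2) a second-difference bound `ℓ₂·d²` for the
new total action `a ↦ newTerm {D k with Q := 𝐄_k^h ∘ τ k} a U + R k a U` in its LAST coupling on arithmetic triples of the window (the birth
step; [Balaban1987RG1] p. 263's C^∞ clause at second order, any currency).  CONCLUSION: for every history `g ∈ W^ℕ`, every OLDER coupling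
`i < k`, every triple `t − d, t, t + d ∈ W` (`d > 0`) and every `U ∈ Dom k`:
`|𝐄_k(g[i ↦ t+d]; U) − 2𝐄_k(g[i ↦ t]; U) + 𝐄_k(g[i ↦ t−d]; U)| ≤ (ℓ₂ + 2L₁²·(k − 1 − i))·d²` — LINEAR growth in the age, NO smallness: the
birth step contributes `ℓ₂`, every later step adds the variance channel `2(L₁d)²` of the bracket (module 11) and carries the old second
difference with factor ONE. [cite: Balaban1987RG1, §0 (0.23) p.256, (2.11)–(2.13) pp.267–268, p.263 and §5 p.298] -/
theorem abs_secondDiff_action_le_linear_of_shapes (D : ℕ → FluctData Y) (τ : (k : ℕ) → ℝ → Y → (D k).𝓑 → Y)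
    (R : ℕ → ℝ → Y → ℝ) (E : ℕ → (ℕ → ℝ) → Y → ℝ) (Dom : ℕ → Set Y) (W : Set ℝ) {L₁ ℓ₂ : ℝ}
    (hE0 : ∀ h h' : ℕ → ℝ, ∀ U, E 0 h U = E 0 h' U)
    (hrec : ∀ (h : ℕ → ℝ) (k : ℕ) (U : Y), (∀ i, h i ∈ W) →
      E (k + 1) h U = FluctData.newTerm { D k with Q := fun a U B => E k h (τ k a U B) } (h k) U + R k (h k) U)
    (hτ : ∀ k U, U ∈ Dom (k + 1) → ∀ a ∈ W, ∀ B, (D k).χ U B ≠ 0 → τ k a U B ∈ Dom k)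
    (hint : ∀ (h : ℕ → ℝ) (k : ℕ), (∀ i, h i ∈ W) → ∀ U ∈ Dom (k + 1), ∀ a ∈ W,
      Integrable (FluctData.integrand { D k with Q := fun a U B => E k h (τ k a U B) } a U) ((D k).μ U))
    (hpos : ∀ (h : ℕ → ℝ) (k : ℕ), (∀ i, h i ∈ W) → ∀ U ∈ Dom (k + 1), ∀ a ∈ W,
      0 < FluctData.integral { D k with Q := fun a U B => E k h (τ k a U B) } a U)
    (hL1 : ∀ g g' : ℕ → ℝ, (∀ j, g j ∈ W) → (∀ j, g' j ∈ W) → ∀ k, ∀ y ∈ Dom k,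
      |E k g' y - E k g y| ≤ L₁ * ∑ j ∈ Finset.range k, |g' j - g j|)
    (hB2 : ∀ h : ℕ → ℝ, (∀ j, h j ∈ W) → ∀ k, ∀ U ∈ Dom (k + 1), ∀ t d : ℝ, 0 < d → t - d ∈ W → t ∈ W → t + d ∈ W →
      |(FluctData.newTerm { D k with Q := fun a U B => E k h (τ k a U B) } (t + d) U + R k (t + d) U)
        - 2 * (FluctData.newTerm { D k with Q := fun a U B => E k h (τ k a U B) } t U + R k t U)
        + (FluctData.newTerm { D k with Q := fun a U B => E k h (τ k a U B) } (t - d) U + R k (t - d) U)| ≤ ℓ₂ * d ^ 2) :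
    ∀ g : ℕ → ℝ, (∀ j, g j ∈ W) → ∀ (i k : ℕ), i < k → ∀ t d : ℝ, 0 < d → t - d ∈ W → t ∈ W → t + d ∈ W →
      ∀ U ∈ Dom k,
        |E k (Function.update g i (t + d)) U - 2 * E k (Function.update g i t) U + E k (Function.update g i (t - d)) U|
          ≤ (ℓ₂ + 2 * L₁ ^ 2 * ((k - 1 - i : ℕ) : ℝ)) * d ^ 2 := by
  intro g hg i k hik t d hd htm ht htp
  -- histories updated at `i` by a value of the window stay in the window; prefix dependence (§1)
  have hW : ∀ s ∈ W, ∀ j, Function.update g i s j ∈ W := fun s hs => update_mem_of_mem hg i hs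
  have hPref := prefix_eq D τ R E W hE0 hrec
  -- write `k = i + 1 + n` and induct on `n`
  obtain ⟨n, rfl⟩ : ∃ n, k = i + 1 + n := ⟨k - 1 - i, by omega⟩
  rw [show i + 1 + n - 1 - i = n by omega]
  induction n with
  | zero =>
    -- the BIRTH step `k = i + 1`: the coupling `i` is the last one; the three old actions coincide (§1)
    intro U hU
    rw [Nat.add_zero] at hU ⊢
    have hEq : ∀ s ∈ W, E i (Function.update g i s) = E i g := fun s hs =>
      funext fun V => hPref i _ _ (hW s hs) hg (fun j hj => by rw [Function.update_of_ne (Nat.ne_of_lt hj)]) V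
    rw [hrec _ i U (hW _ htp), hrec _ i U (hW _ ht), hrec _ i U (hW _ htm), hEq _ htp, hEq _ ht, hEq _ htm]
    simp only [Function.update_self, Nat.cast_zero, mul_zero, add_zero]
    exact hB2 g hg i U hU t d hd htm ht htp
  | succ n ih =>
    -- a LATER step `k + 1`, `k = i + 1 + n > i`: three old actions in the bracket at the same last coupling `g k`
    intro U hU
    have hik' : i < i + 1 + n := by omega
    set k := i + 1 + n with hk
    rw [show i + 1 + (n + 1) = k + 1 by omega] at hU ⊢
    have hki : k ≠ i := by omega
    rw [hrec _ k U (hW _ htp), hrec _ k U (hW _ ht), hrec _ k U (hW _ htm)]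
    simp only [Function.update_of_ne hki]
    -- first differences of the old actions: `L₁·d` (shape (L1)); second differences: the induction hypothesis
    have h1 : ∀ y ∈ Dom k, |E k (Function.update g i t) y - E k (Function.update g i (t - d)) y| ≤ L₁ * d := by
      intro y hy
      have h := hL1 _ _ (hW _ htm) (hW _ ht) k y hy
      rwa [sum_abs_update_sub_update g hik', show t - (t - d) = d by ring, abs_of_pos hd] at h
    have step := abs_step_secondDiff_old (D k) (τ k) (R k) (E k (Function.update g i (t - d)))
      (E k (Function.update g i t)) (E k (Function.update g i (t + d))) (Dom k) (a := g k) h1 (ih hik')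
      (fun B hB => hτ k U hU (g k) (hg k) B hB)
      (hint _ k (hW _ htm) U hU (g k) (hg k)) (hint _ k (hW _ ht) U hU (g k) (hg k))
      (hint _ k (hW _ htp) U hU (g k) (hg k)) (hpos _ k (hW _ ht) U hU (g k) (hg k))
    refine step.trans (le_of_eq ?_)
    push_cast
    ring

/-- **THE SUBTRACTED NEW TERM OF (2.13) AT SECOND ORDER.**  Under the hypotheses of `abs_secondDiff_action_le_linear_of_shapes`, for `i < k`,
a triple `t − d, t, t + d ∈ W`, `U ∈ Dom (k+1)` and a point `σ U ∈ Dom k` (the new field read through `U_k(V^{(k)}(·))`), Bałaban's SUBTRACTED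
new term `𝐄^{(k+1)}_h(g_k, U) = newTerm {D k with Q := 𝐄_k^h ∘ τ k − 𝐄_k^h(σU)} (g k) U` (the curly bracket of (2.12)–(2.13)) has second
difference in the older coupling `g_i` at most `2·(ℓ₂ + 2L₁²·(k − i))·d²` — by module 9's cancellation `newTerm_bracket_add_carried` it is the
new total action minus `R k (g k) U` minus the carried `𝐄_k^h(σU)`, and the tower applies at the levels `k + 1` and `k`.
[cite: Balaban1987RG1, (2.12)–(2.13) p.268 and §0 (0.23) p.256] -/
theorem abs_secondDiff_newTerm_le_linear_of_shapes (D : ℕ → FluctData Y) (τ : (k : ℕ) → ℝ → Y → (D k).𝓑 → Y)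
    (R : ℕ → ℝ → Y → ℝ) (E : ℕ → (ℕ → ℝ) → Y → ℝ) (Dom : ℕ → Set Y) (W : Set ℝ) {L₁ ℓ₂ : ℝ}
    (hE0 : ∀ h h' : ℕ → ℝ, ∀ U, E 0 h U = E 0 h' U)
    (hrec : ∀ (h : ℕ → ℝ) (k : ℕ) (U : Y), (∀ i, h i ∈ W) →
      E (k + 1) h U = FluctData.newTerm { D k with Q := fun a U B => E k h (τ k a U B) } (h k) U + R k (h k) U)
    (hτ : ∀ k U, U ∈ Dom (k + 1) → ∀ a ∈ W, ∀ B, (D k).χ U B ≠ 0 → τ k a U B ∈ Dom k)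
    (hint : ∀ (h : ℕ → ℝ) (k : ℕ), (∀ i, h i ∈ W) → ∀ U ∈ Dom (k + 1), ∀ a ∈ W,
      Integrable (FluctData.integrand { D k with Q := fun a U B => E k h (τ k a U B) } a U) ((D k).μ U))
    (hpos : ∀ (h : ℕ → ℝ) (k : ℕ), (∀ i, h i ∈ W) → ∀ U ∈ Dom (k + 1), ∀ a ∈ W,
      0 < FluctData.integral { D k with Q := fun a U B => E k h (τ k a U B) } a U)
    (hL1 : ∀ g g' : ℕ → ℝ, (∀ j, g j ∈ W) → (∀ j, g' j ∈ W) → ∀ k, ∀ y ∈ Dom k,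
      |E k g' y - E k g y| ≤ L₁ * ∑ j ∈ Finset.range k, |g' j - g j|)
    (hB2 : ∀ h : ℕ → ℝ, (∀ j, h j ∈ W) → ∀ k, ∀ U ∈ Dom (k + 1), ∀ t d : ℝ, 0 < d → t - d ∈ W → t ∈ W → t + d ∈ W →
      |(FluctData.newTerm { D k with Q := fun a U B => E k h (τ k a U B) } (t + d) U + R k (t + d) U)
        - 2 * (FluctData.newTerm { D k with Q := fun a U B => E k h (τ k a U B) } t U + R k t U)
        + (FluctData.newTerm { D k with Q := fun a U B => E k h (τ k a U B) } (t - d) U + R k (t - d) U)| ≤ ℓ₂ * d ^ 2)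
    (σ : Y → Y) {g : ℕ → ℝ} (hg : ∀ j, g j ∈ W) {i k : ℕ} (hik : i < k) {t d : ℝ} (hd : 0 < d)
    (htm : t - d ∈ W) (ht : t ∈ W) (htp : t + d ∈ W) {U : Y} (hU : U ∈ Dom (k + 1)) (hσ : σ U ∈ Dom k) :
    |FluctData.newTerm
          { D k with Q := fun a U B => E k (Function.update g i (t + d)) (τ k a U B) - E k (Function.update g i (t + d)) (σ U) }
          (g k) U
      - 2 * FluctData.newTerm
          { D k with Q := fun a U B => E k (Function.update g i t) (τ k a U B) - E k (Function.update g i t) (σ U) } (g k) U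
      + FluctData.newTerm
          { D k with Q := fun a U B => E k (Function.update g i (t - d)) (τ k a U B) - E k (Function.update g i (t - d)) (σ U) }
          (g k) U|
      ≤ 2 * (ℓ₂ + 2 * L₁ ^ 2 * ((k - i : ℕ) : ℝ)) * d ^ 2 := by
  have hW : ∀ s ∈ W, ∀ j, Function.update g i s j ∈ W := fun s hs => update_mem_of_mem hg i hs
  have hki : k ≠ i := Nat.ne_of_gt hik
  have htow := abs_secondDiff_action_le_linear_of_shapes D τ R E Dom W hE0 hrec hτ hint hpos hL1 hB2 g hg i
  -- the subtracted new term = new total action − remainder − carried old action (module 9's cancellation)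
  have hsub : ∀ s ∈ W,
      FluctData.newTerm { D k with Q := fun a U B => E k (Function.update g i s) (τ k a U B) - E k (Function.update g i s) (σ U) } (g k) U
        = E (k + 1) (Function.update g i s) U - R k (g k) U - E k (Function.update g i s) (σ U) := by
    intro s hs
    have hc := newTerm_bracket_add_carried (D k) (τ k) σ (E k (Function.update g i s)) (g k) U
      (hpos _ k (hW s hs) U hU (g k) (hg k))
    have hr := hrec (Function.update g i s) k U (hW s hs)
    rw [Function.update_of_ne hki] at hr
    linarith
  rw [hsub _ htp, hsub _ ht, hsub _ htm]
  have hA := htow (k + 1) (Nat.lt_succ_of_lt hik) t d hd htm ht htp U hU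
  have hB := htow k hik t d hd htm ht htp (σ U) hσ
  rw [show k + 1 - 1 - i = k - i by omega] at hA
  -- the level-`k` constant is below the level-`(k+1)` one
  have hmono : (ℓ₂ + 2 * L₁ ^ 2 * ((k - 1 - i : ℕ) : ℝ)) * d ^ 2 ≤ (ℓ₂ + 2 * L₁ ^ 2 * ((k - i : ℕ) : ℝ)) * d ^ 2 := by
    have hcast : ((k - 1 - i : ℕ) : ℝ) ≤ ((k - i : ℕ) : ℝ) := by exact_mod_cast (by omega : k - 1 - i ≤ k - i)
    have h2 : 0 ≤ 2 * L₁ ^ 2 := by positivity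
    nlinarith [sq_nonneg d, mul_le_mul_of_nonneg_left hcast h2]
  rw [show E (k + 1) (Function.update g i (t + d)) U - R k (g k) U - E k (Function.update g i (t + d)) (σ U)
      - 2 * (E (k + 1) (Function.update g i t) U - R k (g k) U - E k (Function.update g i t) (σ U))
      + (E (k + 1) (Function.update g i (t - d)) U - R k (g k) U - E k (Function.update g i (t - d)) (σ U))
      = (E (k + 1) (Function.update g i (t + d)) U - 2 * E (k + 1) (Function.update g i t) U
          + E (k + 1) (Function.update g i (t - d)) U)
        - (E k (Function.update g i (t + d)) (σ U) - 2 * E k (Function.update g i t) (σ U)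
          + E k (Function.update g i (t - d)) (σ U)) by ring]
  calc _ ≤ |E (k + 1) (Function.update g i (t + d)) U - 2 * E (k + 1) (Function.update g i t) U
          + E (k + 1) (Function.update g i (t - d)) U|
        + |E k (Function.update g i (t + d)) (σ U) - 2 * E k (Function.update g i t) (σ U)
          + E k (Function.update g i (t - d)) (σ U)| := abs_sub _ _
    _ ≤ _ := add_le_add hA (hB.trans hmono)
    _ = 2 * (ℓ₂ + 2 * L₁ ^ 2 * ((k - i : ℕ) : ℝ)) * d ^ 2 := by ring

end Body

end Summit.QuantumFields.YangMills.BalabanUVNodes.N22KnitBodyTower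

end
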